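import Mathlib
import HarnessLib
import Literature.Analysis.FluidPDE.ClassicalSolution
import Literature.Analysis.FluidPDE.SobolevWholeSpace
import Summits.NavierStokesRegularity.NavierStokesRegularity.Theorems.QuarterJoltSliceTestStatic

/-!
# Route QuarterJolt — crux `NoTerminalJolt` (stmt-NavierStokesRegularity-26463), LEAD line
# `regular_split` rev 5: SLICE TESTING, `H¹` form, I — the transport term through `L⁴` and
# Ladyzhenskaya's inequality

Seat ns-ntj-p1 g4 (LEAD of the crux; `--supports 26463 --as helper`). First file of the ENSTROPHY-RATE
ENERGY EQUALITY chain (`…TransportL4` → `…StaticH1` → `…IncrementH1` →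
`QuarterJoltEnstrophyRateEnergyEquality`): at a first blow-up time `T` with the ENSTROPHY RATE
`∫|Du(t)|²_F ≤ M (T−t)^{−α}`, `α < 4/5`, the energy has NO JUMP (`‖u(t) − u(T)‖_{L²} → 0`). Same slice
testing as the Type-I chain (p638099–p639589), but the transport pairing — integrated by parts onto
the frozen slice `U = u(t)` — is bounded through the `L⁴` norm of the moving slice and
Ladyzhenskaya's inequality, `|∫⟪U,(v·∇)v⟫| ≤ ‖DU‖₂‖v‖₄² ≤ K^{3/2}‖DU‖₂‖v‖₂^{1/2}‖Dv‖₂^{3/2}`, so that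
only the ENSTROPHY of the moving slice enters (no sup norm).

* `abs_integral_inner_convect_self_le_L4` — `|∫⟪U, (v·∇)v⟫| ≤ √(∫|DU|²_F) √(∫‖v‖⁴)`.
* `sqrt_integral_norm_pow_four_le` — `√(∫‖v‖⁴) ≤ K^{3/2} (∫‖v‖²)^{1/4} (∫|Dv|²_F)^{3/4}` with
  Mathlib's Gagliardo–Nirenberg–Sobolev constant `K = SNormLESNormFDerivOfEqConst ℝ³ volume 2` (the
  tree's whole-space `integral_norm_pow_four_le_of_integrable`, Evans §5.6.1).

HONEST FRAMING: a priori calculus for smooth fields; nothing here concerns the truth of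
`NoTerminalJolt` or Navier–Stokes regularity. No summit statement is proved here. [folklore]
-/

noncomputable section

-- the summit and its single sub-problem share the name (CONVENTIONS §1), as in every Theorems file
set_option linter.dupNamespace false

namespace Summit.NavierStokesRegularity.NavierStokesRegularity.Theorems

open MeasureTheory Set Function Filter Topology InnerProductSpace
open scoped ENNReal NNReal ContDiff RealInnerProductSpace Laplacian
open Literature.Analysis.FluidPDE

namespace NoTerminalJolt

/-! ### The transport term through the `L⁴` norm of the moving field -/

/-- **The transport pairing through `L⁴`**: for `v ∈ C¹(ℝ³;ℝ³)` bounded, divergence free, with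
`v, Dv ∈ L²`, and `U ∈ C¹` with `U, DU ∈ L²`:
`|∫⟪U, (v·∇)v⟫| ≤ √(∫|DU|²_F) · √(∫‖v‖⁴)` (integration by parts onto `U`,
`integral_inner_convect_self_eq_neg`, then Cauchy–Schwarz with `‖(v·∇)U‖ ≤ ‖DU‖‖v‖`). [folklore] -/
theorem abs_integral_inner_convect_self_le_L4 {U v : EuclideanSpace ℝ (Fin 3) → EuclideanSpace ℝ (Fin 3)}
    (hU : ContDiff ℝ 1 U) (hv : ContDiff ℝ 1 v) (hdivv : VectorCalculus.IsDivFree v)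
    {M : ℝ} (hM : ∀ x, ‖v x‖ ≤ M)
    (l2v : ∫⁻ x, ‖v x‖ₑ ^ 2 < ⊤) (l2Dv : ∫⁻ x, ‖fderiv ℝ v x‖ₑ ^ 2 < ⊤)
    (l2U : ∫⁻ x, ‖U x‖ₑ ^ 2 < ⊤) (l2DU : ∫⁻ x, ‖fderiv ℝ U x‖ₑ ^ 2 < ⊤) :
    |∫ x, ⟪U x, convect v v x⟫| ≤
      Real.sqrt (∫ x, frobeniusNormSq (fderiv ℝ U x)) * Real.sqrt (∫ x, ‖v x‖ ^ 4) := by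
  have cv : Continuous v := hv.continuous
  have cDU : Continuous (fderiv ℝ U) := hU.continuous_fderiv one_ne_zero
  have hM0 : 0 ≤ M := (norm_nonneg _).trans (hM 0)
  rw [integral_inner_convect_self_eq_neg hU hv hdivv hM l2v l2Dv l2U l2DU, abs_neg]
  -- the real function `x ↦ ‖v x‖²` is continuous with `∫ (‖v‖²)² = ∫‖v‖⁴ < ∞`
  have csq : Continuous fun x => ‖v x‖ ^ 2 := cv.norm.pow 2
  have isq : Integrable (fun x => ‖v x‖ ^ 2) volume := integrable_sq_norm_of_lintegral_lt_top cv l2v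
  have i4 : Integrable (fun x => ‖(‖v x‖ ^ 2)‖ ^ 2) volume := by
    refine Integrable.mono' (isq.const_mul (M ^ 2)) (csq.norm.pow 2).aestronglyMeasurable
      (Eventually.of_forall fun x => ?_)
    rw [Real.norm_of_nonneg (by positivity), Real.norm_of_nonneg (by positivity)]
    have h1 : ‖v x‖ ^ 2 ≤ M ^ 2 := by
      have := hM x
      nlinarith [norm_nonneg (v x)]
    calc (‖v x‖ ^ 2) ^ 2 = ‖v x‖ ^ 2 * ‖v x‖ ^ 2 := by ring
      _ ≤ M ^ 2 * ‖v x‖ ^ 2 := mul_le_mul_of_nonneg_right h1 (by positivity)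
  have iDU2 : Integrable (fun x => ‖fderiv ℝ U x‖ ^ 2) volume :=
    integrable_sq_norm_of_lintegral_lt_top cDU l2DU
  have hpt : ∀ x, ‖⟪convect v U x, v x⟫‖ ≤ ‖fderiv ℝ U x‖ * ‖(‖v x‖ ^ 2)‖ := fun x => by
    rw [Real.norm_of_nonneg (by positivity : (0 : ℝ) ≤ ‖v x‖ ^ 2)]
    calc ‖⟪convect v U x, v x⟫‖ ≤ ‖convect v U x‖ * ‖v x‖ := norm_inner_le_norm _ _
      _ ≤ (‖fderiv ℝ U x‖ * ‖v x‖) * ‖v x‖ :=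
          mul_le_mul_of_nonneg_right ((fderiv ℝ U x).le_opNorm (v x)) (norm_nonneg _)
      _ = ‖fderiv ℝ U x‖ * ‖v x‖ ^ 2 := by ring
  have iR : Integrable (fun x => (‖fderiv ℝ U x‖ ^ 2 + ‖(‖v x‖ ^ 2)‖ ^ 2) / 2) volume :=
    (iDU2.add i4).div_const 2
  have iprod : Integrable (fun x => ‖fderiv ℝ U x‖ * ‖(‖v x‖ ^ 2)‖) volume := by
    refine Integrable.mono' iR (cDU.norm.mul csq.norm).aestronglyMeasurable
      (Eventually.of_forall fun x => ?_)
    rw [Real.norm_of_nonneg (by positivity)]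
    nlinarith [sq_nonneg (‖fderiv ℝ U x‖ - ‖(‖v x‖ ^ 2)‖), norm_nonneg (fderiv ℝ U x),
      norm_nonneg (‖v x‖ ^ 2)]
  have h1 : |∫ x, ⟪convect v U x, v x⟫| ≤ ∫ x, ‖fderiv ℝ U x‖ * ‖(‖v x‖ ^ 2)‖ := by
    rw [← Real.norm_eq_abs]
    exact (norm_integral_le_integral_norm _).trans (integral_mono_of_nonneg
      (Eventually.of_forall fun x => norm_nonneg _) iprod (Eventually.of_forall hpt))
  have h2 := integral_norm_mul_norm_le_sqrt cDU csq iDU2 i4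
  have h4 : (fun x => ‖(‖v x‖ ^ 2)‖ ^ 2) = fun x => ‖v x‖ ^ 4 := by
    funext x; rw [Real.norm_of_nonneg (by positivity)]; ring
  rw [h4] at h2
  have ifrobU : Integrable (fun x => frobeniusNormSq (fderiv ℝ U x)) volume := by
    have hlt : ∫⁻ x, ENNReal.ofReal (frobeniusNormSq (fderiv ℝ U x)) < ⊤ :=
      calc ∫⁻ x, ENNReal.ofReal (frobeniusNormSq (fderiv ℝ U x))
          ≤ ∫⁻ x, 3 * ‖fderiv ℝ U x‖ₑ ^ 2 :=
            lintegral_mono fun x => ofReal_frobeniusNormSq_le_three_mul_enorm_sq _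
        _ = 3 * ∫⁻ x, ‖fderiv ℝ U x‖ₑ ^ 2 := lintegral_const_mul' _ _ (by norm_num)
        _ < ⊤ := ENNReal.mul_lt_top (by norm_num) l2DU
    exact integrable_of_continuous_of_nonneg (continuous_frobeniusNormSq_fderiv hU (by simp))
      (fun x => frobeniusNormSq_nonneg _) hlt
  have h5 : Real.sqrt (∫ x, ‖fderiv ℝ U x‖ ^ 2) ≤ Real.sqrt (∫ x, frobeniusNormSq (fderiv ℝ U x)) :=
    Real.sqrt_le_sqrt (integral_mono iDU2 ifrobU fun x => sq_opNorm_le_frobeniusNormSq _)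
  exact (h1.trans h2).trans (mul_le_mul_of_nonneg_right h5 (Real.sqrt_nonneg _))

/-- **Ladyzhenskaya's inequality for the slice**: for `v ∈ C¹(ℝ³;ℝ³)` bounded with `v, Dv ∈ L²`,
`√(∫‖v‖⁴) ≤ K^{3/2} (∫‖v‖²)^{1/4} (∫|Dv|²_F)^{3/4}` with Mathlib's Gagliardo–Nirenberg–Sobolev constant
`K = SNormLESNormFDerivOfEqConst ℝ³ volume 2` (the tree's `integral_norm_pow_four_le_of_integrable`,
Evans §5.6.1; `‖Dv‖_{op} ≤ |Dv|_F`). [folklore] -/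
theorem sqrt_integral_norm_pow_four_le {v : EuclideanSpace ℝ (Fin 3) → EuclideanSpace ℝ (Fin 3)}
    (hv : ContDiff ℝ 1 v) {M : ℝ} (hM : ∀ x, ‖v x‖ ≤ M)
    (l2v : ∫⁻ x, ‖v x‖ₑ ^ 2 < ⊤) (l2Dv : ∫⁻ x, ‖fderiv ℝ v x‖ₑ ^ 2 < ⊤) :
    Real.sqrt (∫ x, ‖v x‖ ^ 4) ≤
      (SNormLESNormFDerivOfEqConst (EuclideanSpace ℝ (Fin 3))
          (volume : Measure (EuclideanSpace ℝ (Fin 3))) 2 : ℝ) ^ (3 / 2 : ℝ) *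
        (∫ x, ‖v x‖ ^ 2) ^ (1 / 4 : ℝ) * (∫ x, frobeniusNormSq (fderiv ℝ v x)) ^ (3 / 4 : ℝ) := by
  set K : ℝ := (SNormLESNormFDerivOfEqConst (EuclideanSpace ℝ (Fin 3))
    (volume : Measure (EuclideanSpace ℝ (Fin 3))) 2 : ℝ) with hK
  have hK0 : 0 ≤ K := NNReal.coe_nonneg _
  have cv : Continuous v := hv.continuous
  have cDv : Continuous (fderiv ℝ v) := hv.continuous_fderiv one_ne_zero
  have hM0 : 0 ≤ M := (norm_nonneg _).trans (hM 0)
  have isq : Integrable (fun x => ‖v x‖ ^ 2) volume := integrable_sq_norm_of_lintegral_lt_top cv l2v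
  have i6 : Integrable (fun x => ‖v x‖ ^ 6) volume := by
    refine Integrable.mono' (isq.const_mul (M ^ 4)) (cv.norm.pow 6).aestronglyMeasurable
      (Eventually.of_forall fun x => ?_)
    rw [Real.norm_of_nonneg (by positivity)]
    have h1 : ‖v x‖ ^ 4 ≤ M ^ 4 := pow_le_pow_left₀ (norm_nonneg _) (hM x) 4
    calc ‖v x‖ ^ 6 = ‖v x‖ ^ 4 * ‖v x‖ ^ 2 := by ring
      _ ≤ M ^ 4 * ‖v x‖ ^ 2 := mul_le_mul_of_nonneg_right h1 (by positivity)
  have iD : Integrable (fun x => ‖fderiv ℝ v x‖ ^ 2) volume :=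
    integrable_sq_norm_of_lintegral_lt_top cDv l2Dv
  have hGN := integral_norm_pow_four_le_of_integrable (volume : Measure (EuclideanSpace ℝ (Fin 3)))
    finrank_euclideanSpace_fin hv isq i6 iD
  rw [← hK] at hGN
  set A : ℝ := ∫ x, ‖v x‖ ^ 2 with hA
  set B : ℝ := ∫ x, ‖fderiv ℝ v x‖ ^ 2 with hB
  set Bf : ℝ := ∫ x, frobeniusNormSq (fderiv ℝ v x) with hBf
  have hA0 : 0 ≤ A := integral_nonneg fun x => by positivity
  have hB0 : 0 ≤ B := integral_nonneg fun x => by positivity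
  have ifrobv : Integrable (fun x => frobeniusNormSq (fderiv ℝ v x)) volume := by
    have hlt : ∫⁻ x, ENNReal.ofReal (frobeniusNormSq (fderiv ℝ v x)) < ⊤ :=
      calc ∫⁻ x, ENNReal.ofReal (frobeniusNormSq (fderiv ℝ v x))
          ≤ ∫⁻ x, 3 * ‖fderiv ℝ v x‖ₑ ^ 2 :=
            lintegral_mono fun x => ofReal_frobeniusNormSq_le_three_mul_enorm_sq _
        _ = 3 * ∫⁻ x, ‖fderiv ℝ v x‖ₑ ^ 2 := lintegral_const_mul' _ _ (by norm_num)
        _ < ⊤ := ENNReal.mul_lt_top (by norm_num) l2Dv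
    exact integrable_of_continuous_of_nonneg (continuous_frobeniusNormSq_fderiv hv (by simp))
      (fun x => frobeniusNormSq_nonneg _) hlt
  have hBBf : B ≤ Bf := integral_mono iD ifrobv fun x => sq_opNorm_le_frobeniusNormSq _
  have hBf0 : 0 ≤ Bf := hB0.trans hBBf
  -- `∫‖v‖⁴ ≤ K³ A^{1/2} Bf^{3/2} = (K^{3/2} A^{1/4} Bf^{3/4})²`
  have h4le : ∫ x, ‖v x‖ ^ 4 ≤ K ^ 3 * A ^ (1 / 2 : ℝ) * Bf ^ (3 / 2 : ℝ) := by
    refine hGN.trans ?_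
    have : B ^ (3 / 2 : ℝ) ≤ Bf ^ (3 / 2 : ℝ) := Real.rpow_le_rpow hB0 hBBf (by norm_num)
    have hKA : 0 ≤ K ^ 3 * A ^ (1 / 2 : ℝ) := by positivity
    exact mul_le_mul_of_nonneg_left this hKA
  have hsq : (K ^ (3 / 2 : ℝ) * A ^ (1 / 4 : ℝ) * Bf ^ (3 / 4 : ℝ)) ^ 2 =
      K ^ 3 * A ^ (1 / 2 : ℝ) * Bf ^ (3 / 2 : ℝ) := by
    have e1 : (K ^ (3 / 2 : ℝ)) ^ 2 = K ^ 3 := by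
      rw [← Real.rpow_natCast, ← Real.rpow_mul hK0]; norm_num
    have e2 : (A ^ (1 / 4 : ℝ)) ^ 2 = A ^ (1 / 2 : ℝ) := by
      rw [← Real.rpow_natCast, ← Real.rpow_mul hA0]; norm_num
    have e3 : (Bf ^ (3 / 4 : ℝ)) ^ 2 = Bf ^ (3 / 2 : ℝ) := by
      rw [← Real.rpow_natCast, ← Real.rpow_mul hBf0]; norm_num
    calc (K ^ (3 / 2 : ℝ) * A ^ (1 / 4 : ℝ) * Bf ^ (3 / 4 : ℝ)) ^ 2
        = (K ^ (3 / 2 : ℝ)) ^ 2 * (A ^ (1 / 4 : ℝ)) ^ 2 * (Bf ^ (3 / 4 : ℝ)) ^ 2 := by ring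
      _ = K ^ 3 * A ^ (1 / 2 : ℝ) * Bf ^ (3 / 2 : ℝ) := by rw [e1, e2, e3]
  have hnn : 0 ≤ K ^ (3 / 2 : ℝ) * A ^ (1 / 4 : ℝ) * Bf ^ (3 / 4 : ℝ) := by positivity
  calc Real.sqrt (∫ x, ‖v x‖ ^ 4) ≤ Real.sqrt (K ^ 3 * A ^ (1 / 2 : ℝ) * Bf ^ (3 / 2 : ℝ)) :=
        Real.sqrt_le_sqrt h4le
    _ = K ^ (3 / 2 : ℝ) * A ^ (1 / 4 : ℝ) * Bf ^ (3 / 4 : ℝ) := by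
        rw [← hsq, Real.sqrt_sq hnn]

end NoTerminalJolt

end Summit.NavierStokesRegularity.NavierStokesRegularity.Theorems

end
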